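import Summits.PneNP.PneNP.Theorems.SupportRectangleBlockLiftCells
import Literature.Combinatorics.Optimization.TracialDesigns
import Literature.Combinatorics.Optimization.EquivariantPsdStructure
import HarnessLib

/-!
# Tracial value in BOUNDED dimension is controlled by tight-free rectangles (cell pnp-psdrank, crux API, eng g5)

Crux `TracialDecayExp20` (stmt-PneNP-19878) asks for the tracial value of a Chebyshev design weight on tight-orthogonal
psd rectangles of every dimension `r` with `r²n < exp(a·dq n)`. The tree already has the two easy directions
"dimension `r` ⇒ dimension `1`" (`ChebyshevTracialDesignAmplification.tracialValueLEAt_one_of`) and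
"dimension `1` ⇔ tight-free 0/1 rectangles" (`ChebyshevTracialDesignDimensionOne.tracialValueLEAt_one_iff`). This file adds
the converse AT BOUNDED DIMENSION, by the support-form cube-grid net of the block-lift chain
(`SupportRectangleBlockLift.netBall_supp`): the square-root pieces `⟨√X_U e_p, √Y_M e_q⟩` of a tight-orthogonal psd
rectangle vanish on the tight pairs, so every rectangle on which a piece is nowhere zero is tight-free.

* `sum_trace_le_of_rectangles` — for ANY weight `W ≤ K` (`K ≥ 0`, `ΣK ≤ κ`) whose mass on every tight-free 0/1 rectangle
  is `≤ θ₀`, every tight-orthogonal psd rectangle `(X, Y)` of dimension `r` (`IsPsdRect`) and every grid resolution `L`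
  with `r ≤ L²`, `0 < η ≤ 1`: `Σ W tr(X_U Y_M) ≤ r² ((2L+1)^{2r} θ₀ + η κ + 112 r κ/(η² L²))`;
  `tracialValueLEAt_of_rectangles` — the same as `TracialValueLEAt W (r·(…)) r`;
* `levelWeight_le_absWeight`, `sum_absWeight_le` — a design weight of total variation `B` is dominated by a kernel of
  mass `≤ B`;
* `tracialDecay_boundedDim_of_rectangleDecay` — **the exp-scale `r = 1` rung implies the exp-scale crux restricted to
  dimensions `r ≤ r₀`**: if for some `a > 0` every balanced `B = 20` design weight has mass `≤ exp(−a·dq n)` on tight-free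
  rectangles (all large even `n`), then for every `r₀` it has tracial value `≤ exp(−a'·dq n)`, `a' = a/(8(r₀+1))`, on
  tight-orthogonal psd rectangles of every dimension `1 ≤ r ≤ r₀` (all large even `n`).

Reading for the route: at FIXED dimension the psd crux and its classical shadow are equivalent up to the constant `a`;
the open content of `TracialDecayExp20` is the GROWTH of the dimension budget (`r` up to `exp(a·dq n/2)`), where the
`(2L+1)^{2r}` cells of the net are unaffordable (cf. planner p1's N2-SpreadStructure.md §SNT(4)). WHAT THIS IS NOT: not a
proof of any rung (the `r = 1` exp rung is itself open); no claim for growing `r`; nothing P ≠ NP-relevant.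
[cite: Rothvoss2017, Lemma 5–7 (the `r = 1` currency)] [cite: BrietDadushPokutta2014, Thm. 6]
-/

set_option linter.dupNamespace false -- `Summit.PneNP.PneNP.…`: summit = sub-problem (D-0017)

noncomputable section

open scoped Classical MatrixOrder

open Finset Real Matrix Literature.Barriers.PneNP Literature.Combinatorics.Optimization
  Literature.Combinatorics.Optimization.EquivariantPsdStructure
  Summit.PneNP.PneNP.Theorems.SupportRectangleBlockLift

namespace Summit.PneNP.PneNP.Theorems.ChebyshevTracialDesignBoundedDim

variable {n : ℕ}

/-! ### Bounded dimension from tight-free rectangles -/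

/-- **Tracial value in dimension `r` from the tight-free rectangle bound.** Let `W ≤ K` with `K ≥ 0`, `ΣK ≤ κ`, and
`Σ_{A×B} W ≤ θ₀` (`θ₀ ≥ 0`) for every 0/1 rectangle `A × B` avoiding the tight pairs. Then for every tight-orthogonal
psd rectangle `(X, Y)` of dimension `r`, every `0 < η ≤ 1` and every grid resolution `L ≥ 1` with `r ≤ L²`:
`Σ_{U,M} W(U,M) tr(X_U Y_M) ≤ r² ((2L+1)^{2r} θ₀ + η κ + 112 r κ/(η² L²))`. -/
theorem sum_trace_le_of_rectangles (W K : OddSet n → PMatch n → ℝ) {θ₀ η κ : ℝ}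
    (hK0 : ∀ U M, 0 ≤ K U M) (hWK : ∀ U M, W U M ≤ K U M) (hKsum : ∑ U, ∑ M, K U M ≤ κ)
    (hθ : 0 ≤ θ₀) (hη : 0 < η) (hη1 : η ≤ 1)
    (hrect : ∀ (A : Finset (OddSet n)) (B : Finset (PMatch n)), (∀ U ∈ A, ∀ M ∈ B, cc U M ≠ 1) →
      ∑ U ∈ A, ∑ M ∈ B, W U M ≤ θ₀)
    {r : ℕ} (L : ℕ) (hL : 0 < L) (hrL : r ≤ L ^ 2)
    (X : OddSet n → Matrix (Fin r) (Fin r) ℝ) (Y : PMatch n → Matrix (Fin r) (Fin r) ℝ) (hXY : IsPsdRect X Y) :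
    ∑ U, ∑ M, W U M * (X U * Y M).trace ≤
      (r : ℝ) ^ 2 * (((2 * L + 1 : ℝ) ^ r) ^ 2 * θ₀ + η * κ + 112 * r / (η ^ 2 * (L : ℝ) ^ 2) * κ) := by
  obtain ⟨hX, hY, htight⟩ := hXY
  -- the square-root pieces
  set d : (Fin r × Fin r) → OddSet n → PMatch n → ℝ :=
    fun pq U M => sqrtRow (X U) pq.1 ⬝ᵥ sqrtRow (Y M) pq.2 with hd
  have htr : ∀ U M, (X U * Y M).trace = ∑ pq : Fin r × Fin r, d pq U M ^ 2 := by
    intro U M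
    rw [trace_mul_eq_sum_sq_sqrtRow (hX U).1 (hY M).1, Fintype.sum_prod_type]
  -- pieces vanish on the tight pairs
  have hd0 : ∀ pq U M, cc U M = 1 → d pq U M = 0 := by
    intro pq U M hcc
    have h0 : ∑ pq' : Fin r × Fin r, d pq' U M ^ 2 = 0 := by
      rw [← htr U M, htight U M hcc, trace_zero]
    have h1 := (sum_eq_zero_iff_of_nonneg fun pq' _ => sq_nonneg (d pq' U M)).1 h0 pq (mem_univ _)
    exact pow_eq_zero_iff two_ne_zero |>.1 h1
  -- per-piece net
  have hκ : ∑ U, ∑ M, K U M ≤ κ := hKsum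
  have hKs0 : 0 ≤ ∑ U, ∑ M, K U M := sum_nonneg fun U _ => sum_nonneg fun M _ => hK0 U M
  have hκ0 : 0 ≤ κ := le_trans hKs0 hκ
  set τ : ℝ := 112 * r / (η ^ 2 * (L : ℝ) ^ 2) with hτ
  have hτ0 : 0 ≤ τ := by rw [hτ]; positivity
  have hpiece : ∀ pq : Fin r × Fin r, ∑ U, ∑ M, W U M * d pq U M ^ 2 ≤
      ((2 * L + 1 : ℝ) ^ r) ^ 2 * θ₀ + η * κ + τ * κ := by
    intro pq
    have hnet := netBall_supp W K θ₀ η τ L (fun U => sqrtRow (X U) pq.1) (fun M => sqrtRow (Y M) pq.2)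
      hK0 hWK hθ hη hη1 hL hrL (fun U => sqrtRow_sq_le_one (hX U).1 (hX U).2 _)
      (fun M => sqrtRow_sq_le_one (hY M).1 (hY M).2 _) ?_ le_rfl
    · -- `Σ K d² ≤ κ` (each `d² ≤ 1`) and `τ ΣK ≤ τ κ`
      have hd1 : ∀ U M, d pq U M ^ 2 ≤ 1 := by
        intro U M
        have h1 := SmallBlockRothvossBallGrid.dotProduct_sq_le_mul
          (sqrtRow_sq_le_one (hX U).1 (hX U).2 pq.1) (sqrtRow_sq_le_one (hY M).1 (hY M).2 pq.2)
        simpa [hd] using h1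
      have hKd : ∑ U, ∑ M, K U M * (sqrtRow (X U) pq.1 ⬝ᵥ sqrtRow (Y M) pq.2) ^ 2 ≤ κ := by
        refine le_trans (sum_le_sum fun U _ => sum_le_sum fun M _ => ?_) hκ
        have := mul_le_mul_of_nonneg_left (hd1 U M) (hK0 U M)
        simpa [hd] using this
      have h2 : η * ∑ U, ∑ M, K U M * (sqrtRow (X U) pq.1 ⬝ᵥ sqrtRow (Y M) pq.2) ^ 2 ≤ η * κ :=
        mul_le_mul_of_nonneg_left hKd hη.le
      have h3 : τ * ∑ U, ∑ M, K U M ≤ τ * κ := mul_le_mul_of_nonneg_left hκ hτ0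
      have hnet' : ∑ U, ∑ M, W U M * d pq U M ^ 2 =
          ∑ U, ∑ M, W U M * (sqrtRow (X U) pq.1 ⬝ᵥ sqrtRow (Y M) pq.2) ^ 2 := by simp [hd]
      rw [hnet']
      linarith
    · -- rectangles on which the piece is nowhere zero are tight-free
      intro A B hAB
      exact hrect A B fun U hU M hM hcc => hAB U hU M hM (hd0 pq U M hcc)
  -- sum over the `r²` pieces
  set Bnd : ℝ := ((2 * L + 1 : ℝ) ^ r) ^ 2 * θ₀ + η * κ + τ * κ with hBnd
  have hswap : ∑ U, ∑ M, W U M * (X U * Y M).trace = ∑ pq : Fin r × Fin r, ∑ U, ∑ M, W U M * d pq U M ^ 2 := by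
    calc ∑ U, ∑ M, W U M * (X U * Y M).trace
        = ∑ U, ∑ M, ∑ pq : Fin r × Fin r, W U M * d pq U M ^ 2 := by
          refine sum_congr rfl fun U _ => sum_congr rfl fun M _ => ?_
          rw [htr U M, mul_sum]
      _ = ∑ U, ∑ pq : Fin r × Fin r, ∑ M, W U M * d pq U M ^ 2 :=
          sum_congr rfl fun U _ => Finset.sum_comm
      _ = ∑ pq : Fin r × Fin r, ∑ U, ∑ M, W U M * d pq U M ^ 2 := Finset.sum_comm
  have hle : ∑ pq : Fin r × Fin r, ∑ U, ∑ M, W U M * d pq U M ^ 2 ≤ ∑ pq : Fin r × Fin r, (fun _ => Bnd) pq :=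
    sum_le_sum fun pq _ => hpiece pq
  have hcount : ∑ pq : Fin r × Fin r, (fun _ => Bnd) pq = (r : ℝ) ^ 2 * Bnd := by
    rw [sum_const, card_univ, Fintype.card_prod, Fintype.card_fin, nsmul_eq_mul]
    push_cast
    ring
  rw [hswap]
  refine hle.trans ?_
  rw [hcount, hBnd, hτ]

/-- **Packaged form.** Under the hypotheses of `sum_trace_le_of_rectangles`:
`TracialValueLEAt W (r ((2L+1)^{2r} θ₀ + η κ + 112 r κ/(η²L²))) r`. -/
theorem tracialValueLEAt_of_rectangles (W K : OddSet n → PMatch n → ℝ) {θ₀ η κ : ℝ}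
    (hK0 : ∀ U M, 0 ≤ K U M) (hWK : ∀ U M, W U M ≤ K U M) (hKsum : ∑ U, ∑ M, K U M ≤ κ)
    (hθ : 0 ≤ θ₀) (hη : 0 < η) (hη1 : η ≤ 1)
    (hrect : ∀ (A : Finset (OddSet n)) (B : Finset (PMatch n)), (∀ U ∈ A, ∀ M ∈ B, cc U M ≠ 1) →
      ∑ U ∈ A, ∑ M ∈ B, W U M ≤ θ₀)
    {r : ℕ} (L : ℕ) (hL : 0 < L) (hrL : r ≤ L ^ 2) :
    TracialValueLEAt W
      ((r : ℝ) * (((2 * L + 1 : ℝ) ^ r) ^ 2 * θ₀ + η * κ + 112 * r / (η ^ 2 * (L : ℝ) ^ 2) * κ)) r := by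
  intro X Y hXY
  have h := sum_trace_le_of_rectangles W K hK0 hWK hKsum hθ hη hη1 hrect L hL hrL X Y hXY
  have hKs0 : 0 ≤ ∑ U, ∑ M, K U M := sum_nonneg fun U _ => sum_nonneg fun M _ => hK0 U M
  have hκ0 : 0 ≤ κ := le_trans hKs0 hKsum
  have hB0 : 0 ≤ ((2 * L + 1 : ℝ) ^ r) ^ 2 * θ₀ + η * κ + 112 * r / (η ^ 2 * (L : ℝ) ^ 2) * κ := by
    positivity
  rcases Nat.eq_zero_or_pos r with hr | hr
  · subst hr
    simp only [Nat.cast_zero, div_zero, zero_mul]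
    exact le_refl _
  · have hr' : (0 : ℝ) < r := by exact_mod_cast hr
    rw [div_le_iff₀ hr']
    calc ∑ U, ∑ M, W U M * (X U * Y M).trace
        ≤ (r : ℝ) ^ 2 * (((2 * L + 1 : ℝ) ^ r) ^ 2 * θ₀ + η * κ + 112 * r / (η ^ 2 * (L : ℝ) ^ 2) * κ) := h
      _ = (r : ℝ) * (((2 * L + 1 : ℝ) ^ r) ^ 2 * θ₀ + η * κ + 112 * r / (η ^ 2 * (L : ℝ) ^ 2) * κ) * r := by
          ring

/-! ### Design weights are dominated by their total variation -/

/-- The absolute-value kernel of a multilevel weight: `Σ_{c∈C} |w_c| · 1[(U,M) ∈ Q_c] / |Q_c|`. -/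
def absWeight (n t : ℕ) (C : Finset ℕ) (w : ℕ → ℝ) : OddSet n → PMatch n → ℝ :=
  fun U M => ∑ c ∈ C, if (U, M) ∈ Qset n t c then |w c| / ((Qset n t c).card : ℝ) else 0

/-- `absWeight ≥ 0`. -/
theorem absWeight_nonneg (t : ℕ) (C : Finset ℕ) (w : ℕ → ℝ) (U : OddSet n) (M : PMatch n) :
    0 ≤ absWeight n t C w U M :=
  sum_nonneg fun c _ => by split_ifs <;> positivity

/-- `levelWeight ≤ absWeight` pointwise. -/
theorem levelWeight_le_absWeight (t : ℕ) (C : Finset ℕ) (w : ℕ → ℝ) (U : OddSet n) (M : PMatch n) :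
    levelWeight n t C w U M ≤ absWeight n t C w U M := by
  unfold levelWeight absWeight
  refine sum_le_sum fun c _ => ?_
  split_ifs
  · exact div_le_div_of_nonneg_right (le_abs_self _) (Nat.cast_nonneg _)
  · exact le_refl _

/-- The total mass of `absWeight` is at most the total variation `Σ_c |w_c|`. -/
theorem sum_absWeight_le (t : ℕ) (C : Finset ℕ) (w : ℕ → ℝ) :
    ∑ U, ∑ M, absWeight n t C w U M ≤ ∑ c ∈ C, |w c| := by
  unfold absWeight
  calc ∑ U, ∑ M, ∑ c ∈ C, (if (U, M) ∈ Qset n t c then |w c| / ((Qset n t c).card : ℝ) else 0)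
      = ∑ U, ∑ c ∈ C, ∑ M, (if (U, M) ∈ Qset n t c then |w c| / ((Qset n t c).card : ℝ) else 0) :=
        sum_congr rfl fun U _ => sum_comm
    _ = ∑ c ∈ C, ∑ U, ∑ M, (if (U, M) ∈ Qset n t c then |w c| / ((Qset n t c).card : ℝ) else 0) := sum_comm
    _ ≤ ∑ c ∈ C, |w c| := by
        refine sum_le_sum fun c _ => ?_
        rw [sum_sum_ite_mem (Qset n t c) fun _ _ => |w c| / ((Qset n t c).card : ℝ), sum_const, nsmul_eq_mul]
        rcases Nat.eq_zero_or_pos (Qset n t c).card with h0 | hpos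
        · rw [h0]; simp
        · have hc : ((Qset n t c).card : ℝ) ≠ 0 := by exact_mod_cast hpos.ne'
          rw [mul_div_cancel₀ _ hc]

/-! ### The `r = 1` exp rung implies the exp crux at bounded dimension -/

/-- Elementary growth: for `c > 0` and `C ≥ 0` there is `D₀` with `C ≤ exp(c D)` for all `D ≥ D₀`. -/
theorem exists_le_exp_mul {c : ℝ} (hc : 0 < c) (C : ℝ) : ∃ D₀ : ℕ, ∀ D : ℕ, D₀ ≤ D → C ≤ Real.exp (c * D) := by
  obtain ⟨D₀, hD₀⟩ := exists_nat_ge (C / c)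
  refine ⟨D₀, fun D hD => ?_⟩
  have h1 : C ≤ c * D := by
    rw [div_le_iff₀ hc] at hD₀
    have : (D₀ : ℝ) ≤ D := by exact_mod_cast hD
    nlinarith
  linarith [Real.add_one_le_exp (c * D)]

/-- `dq n ≥ D` once `n ≥ D⁴`. -/
theorem le_dq_of_pow_le {D n : ℕ} (h : D ^ 4 ≤ n) : D ≤ dq n := by
  unfold dq
  rw [Nat.le_sqrt, Nat.le_sqrt]
  calc D * D * (D * D) = D ^ 4 := by ring
    _ ≤ n := h

/-- Term 1 of the endgame: `r · η · 20 ≤ γ/3` for `η = γ²`, `r ≤ r₁`, `60 r₁ γ ≤ 1`. -/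
theorem term1_le {r r₁ γ : ℝ} (hr : r ≤ r₁) (hγ : 0 < γ) (hA : 60 * r₁ * γ ≤ 1) :
    r * ((γ * γ) * 20) ≤ γ / 3 := by
  have e1 : r * ((γ * γ) * 20) ≤ r₁ * ((γ * γ) * 20) := mul_le_mul_of_nonneg_right hr (by positivity)
  have e2 : r₁ * ((γ * γ) * 20) = (60 * r₁ * γ) * γ / 3 := by ring
  have e3 : (60 * r₁ * γ) * γ / 3 ≤ 1 * γ / 3 :=
    div_le_div_of_nonneg_right (mul_le_mul_of_nonneg_right hA hγ.le) (by norm_num)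
  linarith

/-- Term 2 of the endgame: `r · 112 r · 20/(η² L²) ≤ γ/3` when `P ≤ η² L²`, `P γ² = 1`, `r ≤ r₁`,
`6720 r₁² γ ≤ 1`. -/
theorem term2_le {r r₁ γ η L P : ℝ} (hr0 : 0 ≤ r) (hr : r ≤ r₁) (hγ : 0 < γ) (hP : P * (γ * γ) = 1)
    (hden : P ≤ η ^ 2 * L ^ 2) (hden0 : 0 < η ^ 2 * L ^ 2) (hA : 6720 * r₁ ^ 2 * γ ≤ 1) :
    r * (112 * r / (η ^ 2 * L ^ 2) * 20) ≤ γ / 3 := by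
  have hr₁ : 0 ≤ r₁ := le_trans hr0 hr
  have hnum : r * (112 * r) * 20 ≤ 2240 * r₁ ^ 2 := by
    have e1 : r * r ≤ r₁ * r₁ := mul_le_mul hr hr hr0 hr₁
    nlinarith
  have hstep : r * (112 * r / (η ^ 2 * L ^ 2) * 20) ≤ 2240 * r₁ ^ 2 * (γ * γ) := by
    have e0 : r * (112 * r / (η ^ 2 * L ^ 2) * 20) = (r * (112 * r) * 20) / (η ^ 2 * L ^ 2) := by
      field_simp
    rw [e0, div_le_iff₀ hden0]
    calc r * (112 * r) * 20 ≤ 2240 * r₁ ^ 2 := hnum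
      _ = 2240 * r₁ ^ 2 * (γ * γ) * P := by
          rw [mul_assoc (2240 * r₁ ^ 2), mul_comm (γ * γ) P, hP, mul_one]
      _ ≤ 2240 * r₁ ^ 2 * (γ * γ) * (η ^ 2 * L ^ 2) := mul_le_mul_of_nonneg_left hden (by positivity)
  have e2 : 2240 * r₁ ^ 2 * (γ * γ) = (6720 * r₁ ^ 2 * γ) * γ / 3 := by ring
  have e3 : (6720 * r₁ ^ 2 * γ) * γ / 3 ≤ 1 * γ / 3 :=
    div_le_div_of_nonneg_right (mul_le_mul_of_nonneg_right hA hγ.le) (by norm_num)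
  linarith

/-- Term 3 of the endgame: `r (2L+1)^{2r} θ₀ ≤ γ/3` when `2L+1 ≤ (2r₀+5)E`, `E ≥ 1`, `r ≤ r₀`,
`E^{2r₀} θ₀ ≤ q γ` and `3(r₀+1)((2r₀+5)^{r₀})² q ≤ 1`. -/
theorem term3_le {r r₀ : ℕ} {L E θ₀ γ q : ℝ} (hrr₀ : r ≤ r₀) (hE1 : 1 ≤ E) (hL0 : 0 ≤ L)
    (h2L : 2 * L + 1 ≤ (2 * (r₀ : ℝ) + 5) * E) (hθ0 : 0 ≤ θ₀) (hγ : 0 < γ)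
    (hEθ : E ^ (2 * r₀) * θ₀ ≤ q * γ) (hC : 3 * ((r₀ : ℝ) + 1) * ((2 * (r₀ : ℝ) + 5) ^ r₀) ^ 2 * q ≤ 1) :
    (r : ℝ) * (((2 * L + 1) ^ r) ^ 2 * θ₀) ≤ γ / 3 := by
  have hr0' : (r : ℝ) ≤ (r₀ : ℝ) + 1 := by
    have : (r : ℝ) ≤ r₀ := by exact_mod_cast hrr₀
    linarith
  have hbase1 : (1 : ℝ) ≤ (2 * (r₀ : ℝ) + 5) * E := by
    have : (2 * (r₀ : ℝ) + 5) * 1 ≤ (2 * (r₀ : ℝ) + 5) * E := mul_le_mul_of_nonneg_left hE1 (by positivity)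
    linarith [(Nat.cast_nonneg r₀ : (0 : ℝ) ≤ r₀)]
  have hpow : ((2 * L + 1) ^ r) ^ 2 ≤ (((2 * (r₀ : ℝ) + 5) * E) ^ r₀) ^ 2 := by
    have e1 : (2 * L + 1) ^ r ≤ ((2 * (r₀ : ℝ) + 5) * E) ^ r := pow_le_pow_left₀ (by linarith) h2L r
    have e2 : ((2 * (r₀ : ℝ) + 5) * E) ^ r ≤ ((2 * (r₀ : ℝ) + 5) * E) ^ r₀ := pow_le_pow_right₀ hbase1 hrr₀
    exact pow_le_pow_left₀ (by positivity) (e1.trans e2) 2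
  have hsplit : (((2 * (r₀ : ℝ) + 5) * E) ^ r₀) ^ 2 = ((2 * (r₀ : ℝ) + 5) ^ r₀) ^ 2 * E ^ (2 * r₀) := by
    rw [mul_pow, mul_pow]
    congr 1
    rw [← pow_mul, mul_comm r₀ 2]
  have hCpos : (0 : ℝ) ≤ 3 * ((r₀ : ℝ) + 1) * ((2 * (r₀ : ℝ) + 5) ^ r₀) ^ 2 := by positivity
  calc (r : ℝ) * (((2 * L + 1) ^ r) ^ 2 * θ₀)
      ≤ ((r₀ : ℝ) + 1) * ((((2 * (r₀ : ℝ) + 5) * E) ^ r₀) ^ 2 * θ₀) :=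
        mul_le_mul hr0' (mul_le_mul_of_nonneg_right hpow hθ0) (by positivity) (by positivity)
    _ = (3 * ((r₀ : ℝ) + 1) * ((2 * (r₀ : ℝ) + 5) ^ r₀) ^ 2) * (E ^ (2 * r₀) * θ₀) / 3 := by
        rw [hsplit]; ring
    _ ≤ (3 * ((r₀ : ℝ) + 1) * ((2 * (r₀ : ℝ) + 5) ^ r₀) ^ 2) * (q * γ) / 3 :=
        div_le_div_of_nonneg_right (mul_le_mul_of_nonneg_left hEθ hCpos) (by norm_num)
    _ = (3 * ((r₀ : ℝ) + 1) * ((2 * (r₀ : ℝ) + 5) ^ r₀) ^ 2 * q) * γ / 3 := by ring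
    _ ≤ 1 * γ / 3 := div_le_div_of_nonneg_right (mul_le_mul_of_nonneg_right hC hγ.le) (by norm_num)
    _ = γ / 3 := by ring

/-- Exponential bookkeeping for the endgame (`γ = e^{−a'D}`, `E = e^{3a'D}`, `η = γ²`, `θ₀ = e^{−aD}`,
`a = 8a'(r₀+1)`). -/
theorem exp_bookkeeping {a a' D : ℝ} {r₀ : ℕ} (ha'0 : 0 ≤ a') (hD0 : 0 ≤ D) (ha8 : 8 * a' * ((r₀ : ℝ) + 1) = a) :
    Real.exp (a' * D) * Real.exp (-(a' * D)) = 1 ∧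
    Real.exp (2 * a' * D) * (Real.exp (-(a' * D)) * Real.exp (-(a' * D))) = 1 ∧
    Real.exp (3 * a' * D) ^ 2 * (Real.exp (-(a' * D)) * Real.exp (-(a' * D))) ^ 2 = Real.exp (2 * a' * D) ∧
    Real.exp (3 * a' * D) ^ (2 * r₀) * Real.exp (-(a * D)) ≤ Real.exp (-(a / 8 * D)) * Real.exp (-(a' * D)) ∧
    Real.exp (a / 8 * D) * Real.exp (-(a / 8 * D)) = 1 := by
  refine ⟨?_, ?_, ?_, ?_, ?_⟩
  · rw [← Real.exp_add]; simp
  · rw [← Real.exp_add, ← Real.exp_add]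
    convert Real.exp_zero using 2; ring
  · rw [← Real.exp_nat_mul, ← Real.exp_add, ← Real.exp_nat_mul, ← Real.exp_add]
    congr 1; push_cast; ring
  · rw [← Real.exp_nat_mul, ← Real.exp_add, ← Real.exp_add]
    refine Real.exp_le_exp.2 ?_
    rw [← ha8]
    push_cast
    nlinarith [mul_nonneg ha'0 hD0, mul_nonneg (mul_nonneg ha'0 hD0) (Nat.cast_nonneg r₀)]
  · rw [← Real.exp_add]; simp

/-- **The exp-scale `r = 1` rung implies the exp-scale crux at every bounded dimension.** If for some `a > 0`
every balanced exact `B = 20` design weight (degree `dq n`, levels `≤ Tq n`) has mass `≤ exp(−a·dq n)` on every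
tight-free 0/1 rectangle for all large even `n` (the `r = 1` shadow of `TracialDecayExp20`, planner p1's
`stub_rung_r1Exp`), then for every `r₀`, with `a' = a/(8(r₀+1))`, for all large even `n` every such design weight has
tracial value `≤ exp(−a'·dq n)` on tight-orthogonal psd rectangles of every dimension `1 ≤ r ≤ r₀`.
(Grid resolution `L = ⌈exp(3a' dq n)⌉ + r₀`, `η = exp(−2a' dq n)`; the three terms of
`tracialValueLEAt_of_rectangles` are each `≤ exp(−a' dq n)/3` once `dq n` is large.) -/
theorem tracialDecay_boundedDim_of_rectangleDecay {a : ℝ} (ha : 0 < a) (r₀ : ℕ)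
    (h : ∃ n₁ : ℕ, ∀ n : ℕ, n₁ ≤ n → Even n → ∀ (t : ℕ) (C : Finset ℕ) (w : ℕ → ℝ),
      IsBalancedDesign n t (Tq n) (dq n) 20 C w →
        ∀ (A : Finset (OddSet n)) (B : Finset (PMatch n)), (∀ U ∈ A, ∀ M ∈ B, cc U M ≠ 1) →
          ∑ U ∈ A, ∑ M ∈ B, levelWeight n t C w U M ≤ Real.exp (-(a * (dq n : ℝ)))) :
    ∃ n₁ : ℕ, ∀ n : ℕ, n₁ ≤ n → Even n → ∀ (t : ℕ) (C : Finset ℕ) (w : ℕ → ℝ),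
      IsBalancedDesign n t (Tq n) (dq n) 20 C w → ∀ r : ℕ, 0 < r → r ≤ r₀ →
        TracialValueLEAt (levelWeight n t C w) (Real.exp (-(a / (8 * ((r₀ : ℝ) + 1)) * (dq n : ℝ)))) r := by
  obtain ⟨n₁, H⟩ := h
  -- the constant `a' = a / (8 (r₀ + 1))`
  have hr₀1 : (0 : ℝ) < (r₀ : ℝ) + 1 := by positivity
  obtain ⟨a', ha'def, ha'0, ha8⟩ : ∃ a' : ℝ, a' = a / (8 * ((r₀ : ℝ) + 1)) ∧ 0 < a' ∧ 8 * a' * ((r₀ : ℝ) + 1) = a :=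
    ⟨a / (8 * ((r₀ : ℝ) + 1)), rfl, by positivity, by field_simp⟩
  rw [← ha'def]
  -- thresholds
  obtain ⟨D₁, hD₁⟩ := exists_le_exp_mul ha'0 (60 * ((r₀ : ℝ) + 1))
  obtain ⟨D₂, hD₂⟩ := exists_le_exp_mul ha'0 (6720 * ((r₀ : ℝ) + 1) ^ 2)
  obtain ⟨D₃, hD₃⟩ := exists_le_exp_mul (show 0 < a / 8 by positivity)
    (3 * ((r₀ : ℝ) + 1) * ((2 * (r₀ : ℝ) + 5) ^ r₀) ^ 2)
  refine ⟨max n₁ ((max D₁ (max D₂ D₃)) ^ 4), fun n hn hev t C w hdes r hr hrr₀ => ?_⟩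
  have hn₁ : n₁ ≤ n := le_trans (le_max_left _ _) hn
  have hD : max D₁ (max D₂ D₃) ≤ dq n := le_dq_of_pow_le (le_trans (le_max_right _ _) hn)
  have hA1 := hD₁ (dq n) (le_trans (le_max_left _ _) hD)
  have hA2 := hD₂ (dq n) (le_trans (le_trans (le_max_left _ _) (le_max_right _ _)) hD)
  have hA3 := hD₃ (dq n) (le_trans (le_trans (le_max_right _ _) (le_max_right _ _)) hD)
  -- exponential bookkeeping at `D = dq n`
  have hD0 : (0 : ℝ) ≤ (dq n : ℝ) := Nat.cast_nonneg _
  obtain ⟨hγinv, hγ2, hE2, hEθ, hinv8⟩ := exp_bookkeeping (D := (dq n : ℝ)) ha'0.le hD0 ha8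
  -- abbreviations
  set D : ℝ := (dq n : ℝ) with hDdef
  set γ : ℝ := Real.exp (-(a' * D)) with hγdef
  set θ₀ : ℝ := Real.exp (-(a * D)) with hθdef
  set E : ℝ := Real.exp (3 * a' * D) with hEdef
  have hγpos : 0 < γ := Real.exp_pos _
  have hθ0 : 0 ≤ θ₀ := (Real.exp_pos _).le
  have hE1 : 1 ≤ E := Real.one_le_exp (by positivity)
  have hγ1 : γ ≤ 1 := Real.exp_le_one_iff.2 (by nlinarith)
  set η : ℝ := γ * γ with hηdef
  have hη : 0 < η := by positivity
  have hη1 : η ≤ 1 := by nlinarith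
  -- grid resolution `L = ⌈E⌉ + r₀`
  obtain ⟨L, hLdef⟩ : ∃ L : ℕ, L = ⌈E⌉₊ + r₀ := ⟨_, rfl⟩
  have hLge : E ≤ (L : ℝ) := by
    rw [hLdef]; push_cast
    linarith [Nat.le_ceil E, (Nat.cast_nonneg r₀ : (0 : ℝ) ≤ r₀)]
  have hLle : (L : ℝ) ≤ E + 1 + r₀ := by
    rw [hLdef]; push_cast
    linarith [(Nat.ceil_lt_add_one (by linarith : (0 : ℝ) ≤ E)).le]
  have hL0 : (0 : ℝ) ≤ L := Nat.cast_nonneg _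
  have hLpos : 0 < L := by exact_mod_cast (show (0 : ℝ) < L by linarith)
  have hr₀L : r₀ ≤ L := by rw [hLdef]; exact Nat.le_add_left r₀ _
  have hrL : r ≤ L ^ 2 := le_trans hrr₀ (le_trans hr₀L (Nat.le_self_pow two_ne_zero L))
  -- the abstract bound
  have hrect := H n hn₁ hev t C w hdes
  have hB : ∑ c ∈ C, |w c| ≤ 20 := hdes.1.2.2.2.2.2.2
  have hKsum : ∑ U, ∑ M, absWeight n t C w U M ≤ 20 := (sum_absWeight_le t C w).trans hB
  have key := tracialValueLEAt_of_rectangles (levelWeight n t C w) (absWeight n t C w)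
    (absWeight_nonneg t C w) (levelWeight_le_absWeight t C w) hKsum hθ0 hη hη1 hrect L hLpos hrL (r := r)
  -- the three terms
  have hr0c : (0 : ℝ) ≤ r := Nat.cast_nonneg r
  have hr0' : (r : ℝ) ≤ (r₀ : ℝ) + 1 := by
    have : (r : ℝ) ≤ r₀ := by exact_mod_cast hrr₀
    linarith
  have hB1 : 60 * ((r₀ : ℝ) + 1) * γ ≤ 1 := by
    calc 60 * ((r₀ : ℝ) + 1) * γ ≤ Real.exp (a' * D) * γ := mul_le_mul_of_nonneg_right hA1 hγpos.le
      _ = 1 := hγinv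
  have hB2 : 6720 * ((r₀ : ℝ) + 1) ^ 2 * γ ≤ 1 := by
    calc 6720 * ((r₀ : ℝ) + 1) ^ 2 * γ ≤ Real.exp (a' * D) * γ := mul_le_mul_of_nonneg_right hA2 hγpos.le
      _ = 1 := hγinv
  have hB3 : 3 * ((r₀ : ℝ) + 1) * ((2 * (r₀ : ℝ) + 5) ^ r₀) ^ 2 * Real.exp (-(a / 8 * D)) ≤ 1 := by
    calc 3 * ((r₀ : ℝ) + 1) * ((2 * (r₀ : ℝ) + 5) ^ r₀) ^ 2 * Real.exp (-(a / 8 * D))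
        ≤ Real.exp (a / 8 * D) * Real.exp (-(a / 8 * D)) :=
          mul_le_mul_of_nonneg_right hA3 (Real.exp_pos _).le
      _ = 1 := hinv8
  have h1 : (r : ℝ) * (η * 20) ≤ γ / 3 := term1_le hr0' hγpos hB1
  have hden : Real.exp (2 * a' * D) ≤ η ^ 2 * (L : ℝ) ^ 2 := by
    rw [← hE2, mul_comm]
    exact mul_le_mul_of_nonneg_left (pow_le_pow_left₀ (by linarith) hLge 2) (by positivity)
  have h2 : (r : ℝ) * (112 * r / (η ^ 2 * (L : ℝ) ^ 2) * 20) ≤ γ / 3 :=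
    term2_le hr0c hr0' hγpos hγ2 hden (by positivity) hB2
  have h2L : 2 * (L : ℝ) + 1 ≤ (2 * (r₀ : ℝ) + 5) * E := by
    have e2 : (2 * (r₀ : ℝ) + 3) * 1 ≤ (2 * (r₀ : ℝ) + 3) * E := mul_le_mul_of_nonneg_left hE1 (by positivity)
    linarith
  have h3 : (r : ℝ) * (((2 * (L : ℝ) + 1) ^ r) ^ 2 * θ₀) ≤ γ / 3 :=
    term3_le hrr₀ hE1 hL0 h2L hθ0 hγpos hEθ hB3
  -- assemble
  intro X Y hXY
  refine (key X Y hXY).trans ?_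
  have hsum : (r : ℝ) * (((2 * L + 1 : ℝ) ^ r) ^ 2 * θ₀ + η * 20 + 112 * r / (η ^ 2 * (L : ℝ) ^ 2) * 20) =
      (r : ℝ) * (((2 * (L : ℝ) + 1) ^ r) ^ 2 * θ₀) + (r : ℝ) * (η * 20) +
        (r : ℝ) * (112 * r / (η ^ 2 * (L : ℝ) ^ 2) * 20) := by ring
  rw [hsum]
  linarith

end Summit.PneNP.PneNP.Theorems.ChebyshevTracialDesignBoundedDim

end
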